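import Literature.MathematicalPhysics.QuantumFieldTheory.Balaban1983to89.B13OpsYPencilDeltaALocal
import Literature.MathematicalPhysics.QuantumFieldTheory.Balaban1983to89.B13InverseOperatorCoordinates

/-!
# `Balaban1983to89.B13OpsYPencilDeltaALetters` — T. Bałaban, *Propagators for lattice gauge theories in a background field*, Commun. Math. Phys. **99** (1985)
# 389–434 [Balaban1985BackgroundPropagators], (3.26)–(3.27) p. 395 («Δ_a(U) = Δ(U) + D_U R(U) D*_U + Q*(U)aQ(U)», «G(U) = Δ_a(U)⁻¹»), (3.10) p. 392 (`Δ(U)`),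
# (3.12)–(3.13) p. 392 (`Q`, `Q*`), (3.2) p. 390 (the contour bonds), Thm 3.4 and (3.50) p. 400 («the operators … G(U) extend to configurations U′U … as analytic
# functions of A′»), Sect. B (3.84)–(3.86) p. 407 («G(U′U) = G(U)(I − V(A)G(U))⁻¹»), Thm 3.10 (3.107)–(3.108) p. 416; *Renormalization group approach to lattice
# gauge field theories. II*, Commun. Math. Phys. **116** (1988) 1–22 [Balaban1988RG2Cluster] (2.5)–(2.7) pp. 12–13, p. 15: THE LOCAL PART `Δ(U) + Q*(U)aQ(U)` OF
# NODE 00's `Δ_a(U)` IN THE N10 ENTRY-LETTER CURRENCY ALONG pv27's GROUP PENCIL `U = e^{iηA′}U₀`, AND THE `Δ_a` ∕ `G` SOCKET MODULO THE PROJECTION TERM.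

statement-level complex analysis and [folklore] unfolding AT NODE 00's `rfl`-level definitions (`hessY curlY coCurlY jordanY curv2Y primeEdgeY edgeY QY QsY aY
deltaAY GAY`), over the lane's module 75 (`B13OpsYPencilDeltaALocal`: the local part along the pencil is holomorphic per input field and output bond, with
majorant), module 56A (`rawEntryLetters_of_range_family`), module 34 (`rawEntryLetters_add`) and width seat n10-w2's reader `B13InverseOperatorCoordinates`
(`rawEntryLetters_toMatrix_of_coordFamily`, `rawEntryLetters_toMatrix_ringInverse_located_of_kernelBound`); kernel-checked; THEOREMS ONLY (no `def`, no
`structure`, no instance, no notation); NOTHING of NODE 00's ∕ pv27's is modified; nothing here is a claim about the Yang–Mills mass gap; no node is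
discharged; count-neutral.

WHY THIS FILE (cell `pub-ymgap`, HUMAN RULING D-0062 ∕ D-0149, Track A node N10 = [B13]; seat `pub-ymgap-dag-n10-c` g15, INTENT-1 = module 76; census
`N10-RESIDUAL-CENSUS-v16.md` item 1 (b)+(c)).  The N10 junction of record (module 67) displays ONE letter datum per (2.14)-term,
`hEL : RawEntryLetters (Δ₀ Z t) (locF Z t) rf.R ρ B` — entrywise (3.108)-type decay + holomorphy of the term's operator on the complex chart ball.  For the
record's bond-sector operator `Δ_a(U)` (3.26) and its inverse `G(U)` (3.27) the tree holds: the pencil letters of every LOCAL constituent (modules 69–75), the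
square `RawEntryLetters` packaging of the SITE-sector local operator `Δ′_a` (n10-w2's `B13OpsYPencilGreenPrime` §3) and the G-JUNCTION SOCKET keyed on the
letters of `A′ ↦ toMatrix (Δ_a(e^{iηA′}U₀))` (n10-w2's `B13InverseOperatorCoordinates.rawEntryLetters_toMatrix_GAY_prodCfg_located`).  THIS FILE closes the
LOCAL side of that input in the bond sector: the square packaging of `Δ(U) + Q*(U)aQ(U)` along the pencil (§1 locality on one-bond fields, §2 range through a
bond reading into [13]'s unit torus, §3 coordinates, §4 packaging), and states the composition with the ONE non-local summand `D_U R(U) D*_U` (whose letters are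
the inverse road's: `R(U) = I − G′Q′*(Q′G′²Q′*)⁻¹Q′G′`, n10-w2's stations) as a socket: §5 the letters of `A′ ↦ toMatrix (Δ_a(e^{iηA′}U₀))` from §4 + the
projection term's displayed letters, §6 the letters of `A′ ↦ toMatrix (G(e^{iηA′}U₀))` from §5 + N06's Theorem 3.3 ∕ 3.10 at the ONE real background `U₀`.

WHAT THIS FILE PROVES (all `theorem`s; `𝔸` NODE 00's complete normed `ℂ`-algebra; `‖1‖ = 1` from §4 on).
* §1 LOCALITY ON ONE-BOND FIELDS (any `U`, any transporter letter `parB`): `curlY_single_apply`, `exists_edgeY_eq_of_curlK_ne_zero` (the curl kernel's support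
  is the plaquette's contour — the statement n06's `B9Eq3104CutoffCommutatorSizes.curlK_ne_zero_imp` proves in bond coordinates, here in NODE 00's `edgeY`
  numbering, same proof over `B6AgreeLapV1Chart.toMatrix'_dcE`), `dKd_single_eq_zero`, `primeEdgeY_single_eq_zero`, `curv2Y_single_eq_zero`,
  ★ `hessY_single_eq_zero` — `(Δ(U)(δ_{b′} ⊗ E))(b) = 0` unless `b` and `b′` are contour bonds of a common plaquette —, `QY_single_apply`,
  ★ `QsaQ_single_eq_zero` — `((Q*aQ)(U)(δ_{b′} ⊗ E))(b) = 0` unless `qsK(b,ι)·aK(ι,ι′)·qK(ι′,b′) ≠ 0` for some `ι, ι′` —, `localDeltaA_single_eq_zero`.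
* §2 THE RANGE READ THROUGH A BOND READING `ℓB : FBondY i → UT Nf` into [13]'s unit torus (NODE 00's dictionary numerals displayed: a plaquette's contour reads as
  `ℓB`-diameter `≤ s`, an averaging link as `≤ s`): `tdist_le_of_hessY_single_ne_zero`, `tdist_le_of_QsaQ_single_ne_zero`, ★ `tdist_le_of_localDeltaA_single_ne_zero`,
  and `linkReading_of_readings` (the averaging-link numeral from three readings with an `IBondY` reading, by the torus triangle inequality).
* §3 `differentiableOn_coord_localDeltaA_prodCfg` (75's holomorphy through a coordinate functional).
* §4 ★★ `rawEntryLetters_toMatrix_localDeltaA_prodCfg` — for a ℂ-basis `b` of `𝔸` with numerals `cb`, `cl`: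
  `RawEntryLetters (A′ ↦ toMatrix B′ B′ (Δ(e^{iηA′}U₀) + (Q*aQ)(e^{iηA′}U₀))) (ℓB ∘ fst) Rc ρ (cb·M₇₅(cl)·e^{ρs})` for EVERY `ρ ≥ 0` (`M₇₅` = 75's majorant at `‖Λ‖ = cl`).
* §5 `toMatrix_deltaAY_eq_add`, ★★ `rawEntryLetters_toMatrix_deltaAY_prodCfg_of_projection` — §4 + the DISPLAYED letters `B_P` of the projection term
  `A′ ↦ toMatrix B′ B′ ((D_U R(U) D*_U)(e^{iηA′}U₀))` ⟹ the letters of `A′ ↦ toMatrix B′ B′ (Δ_a(e^{iηA′}U₀))`, constant `cb·M₇₅(cl)·e^{ρs} + B_P` — EXACTLY input (i)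
  of `B13InverseOperatorCoordinates.rawEntryLetters_toMatrix_GAY_prodCfg_located`.
* §6 ★★★ `rawEntryLetters_toMatrix_GAY_prodCfg_of_projection` — THE G-JUNCTION MODULO ONE OPERATOR-SIDE DATUM: §5 + `prodCfg_zero` + NODE 00's `deltaAY_mul_GAY` fed
  to `rawEntryLetters_toMatrix_ringInverse_located_of_kernelBound` ⟹ `RawEntryLetters (A′ ↦ toMatrix B′ B′ (G(e^{iηA′}U₀))) (ℓB ∘ fst) R₁⋆ ρ′ (2·cb·cl·B_G)` at the
  located thin radius, for every target rate `0 ≤ ρ′ < ρ`, DISPLAYING ONLY: the projection term's letters (the inverse road's), (N06) `IsUnit (Δ_a(U₀))` and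
  Theorem 3.3 ∕ 3.10's pointwise (3.108)-type bound `‖G(U₀)(δ_{b′} ⊗ E)(b)‖ ≤ B_G‖E‖e^{−ρ d(ℓB b, ℓB b′)}` at the ONE real background, (NODE 00) the numerals
  `K₀, c₁, c₂, N_b, D, c_Q, c_{Q*}, c_a`, the reading numeral `s`, the basis numerals, a fibre bound of `ℓB`.
HONEST FRAMING: readers + located numerals + [folklore] unfolding + two compositions; Theorem 3.3 ∕ 3.10 at the centre is N06's displayed content (GAPS
G-B9-05∕06a∕07); the projection term's letters are the inverse road's displayed content; which `ℓB`, `b`, `U₀`, `η`, `parS`, `G′` are «of record» is NODE 00's ∕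
def-Y's ∕ def-T's word; nothing of Bałaban's is asserted; N06 ∕ N10 NOT discharged; K1⁷ NOT closed; counts unmoved (typed 28∕28 · discharged 5∕27); 0 `def`,
0 `sorry`, standard axioms; one finite 𝕋⁴ programme at fixed ε, Bałaban AS PRINTED — R4 closes the conditional finite-𝕋⁴ rung `BalabanLadder.UV` only; the YM mass
gap (Clay) is NOT proved by any of this; nothing continuum ∕ ℝ⁴ ∕ OS.

References: T. Bałaban, CMP 99 (1985) 389–434 [Balaban1985BackgroundPropagators] (3.2) p.390, (3.4) p.391, (3.10) p.392, (3.12)–(3.13) p.392, (3.25)–(3.27) pp.394–395,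
Thm 3.4 and (3.50) p.400, (3.84)–(3.86) p.407, Thm 3.10 (3.107)–(3.108) pp.415–416; CMP 116 (1988) 1–22 [Balaban1988RG2Cluster] (2.5)–(2.7) pp.12–13, p.15;
CMP 96 (1984) 223–250 [Balaban1984PropagatorsII] (2.19) p.226, Lemma 2.1 (2.61) p.234.
-/

noncomputable section

namespace Literature.MathematicalPhysics.QuantumFieldTheory.Balaban1983to89.B13OpsYPencilDeltaALetters

open Metric Set Finset Module
open scoped Matrix
open Literature.MathematicalPhysics.QuantumFieldTheory.Balaban1983to89
open Literature.MathematicalPhysics.QuantumFieldTheory.Balaban1983to89.B9Thm37GlueTorus (tdist1 tdist1_comm tdist1_self tdist1_nonneg tdist1_triangle)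
open Literature.MathematicalPhysics.QuantumFieldTheory.Balaban1983to89.B5TorusCover (UT)
open Literature.MathematicalPhysics.QuantumFieldTheory.Balaban1983to89.B13EntrywiseWalks (RawEntryLetters)
open Literature.MathematicalPhysics.QuantumFieldTheory.Balaban1983to89.B13EntryLetterAlgebra (rawEntryLetters_add rawEntryLetters_congr)
open Literature.MathematicalPhysics.QuantumFieldTheory.Balaban1983to89.B13AccretiveOfRealCoercive (rawEntryLetters_of_range_family)
open Literature.MathematicalPhysics.QuantumFieldTheory.Balaban1983to89.B13InverseOperatorCoordinates
  (rawEntryLetters_toMatrix_of_coordFamily rawEntryLetters_toMatrix_ringInverse_located_of_kernelBound)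
open Literature.MathematicalPhysics.QuantumFieldTheory.Balaban1983to89.B9Eq39Adjoint (R R_def R_zero prodCfg)
open Literature.MathematicalPhysics.QuantumFieldTheory.Balaban1983to89.B9Eq369Product (prodCfg_zero)
open Literature.MathematicalPhysics.QuantumFieldTheory.Balaban1983to89.B6GlobalChartV1 (PV boxEquiv)
open Literature.MathematicalPhysics.QuantumFieldTheory.Balaban1983to89.B6KLevelCensusIndexV1 (KIdx)
open Literature.MathematicalPhysics.QuantumFieldTheory.Balaban1983to89.B15DeterminingSets (embIter)
open Literature.MathematicalPhysics.QuantumFieldTheory.Balaban1983to89.Node00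
  (SiteY FBondY IBondY PlaqY CfgY BondParY SiteParY SiteOpY curlK cocurlK qK qsK aK curlT qT curlY coCurlY jordanY edgeY primeEdgeY curv2Y hessY QY QsY aY
    gradY divY RY deltaAY GAY parBY trLiftY trLiftY_apply cocurlK_eq_transpose deltaAY_mul_GAY)
open Literature.MathematicalPhysics.QuantumFieldTheory.Balaban1983to89.B13OpsYPencilHolonomy (jordanY_apply)
open Literature.MathematicalPhysics.QuantumFieldTheory.Balaban1983to89.B13OpsYPencilHessian (primeEdgeY_apply curv2Y_apply hessY_apply_eq)
open Literature.MathematicalPhysics.QuantumFieldTheory.Balaban1983to89.B13OpsYPencilDeltaALocal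
  (aY_apply differentiableOn_localDeltaA_prodCfg norm_localDeltaA_prodCfg_le)

variable {𝔸 : Type} [NormedRing 𝔸] [NormedAlgebra ℂ 𝔸] [CompleteSpace 𝔸]
variable {d ℓ : ℕ} {hd : 1 ≤ d + 1} {hL : Odd (ℓ + 1) ∧ 1 < ℓ + 1} {b₀ b₁ : ℝ}
variable (i : KIdx d ℓ hd hL b₀ b₁)

/-! ## §1. Locality of `Δ(U)` and `Q*(U)aQ(U)` on one-bond fields (any `U`, any transporter letter) -/

section Locality

variable [DecidableEq (FBondY i)]

/-- The covariant curl of a one-bond field: `(D^η_U(δ_{b′} ⊗ E))(p) = ∂(p,b′)·R(T_p(b′))E`. [cite: Balaban1985BackgroundPropagators, (3.4) p.391, (3.8) p.392] -/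
theorem curlY_single_apply (U : CfgY 𝔸 i) (b' : FBondY i) (E : 𝔸) (p : PlaqY i) :
    curlY i U (Pi.single b' E) p = ((curlK i p b' : ℝ) : ℂ) • R (curlT i U p b') E := by
  simp only [curlY, trLiftY_apply]
  rw [Finset.sum_eq_single b' (fun x _ hx => by rw [Pi.single_eq_of_ne hx, R_zero, smul_zero])
    (fun h => absurd (Finset.mem_univ _) h), Pi.single_eq_same]

omit [DecidableEq (FBondY i)] in
/-- **THE CURL KERNEL's SUPPORT IS THE CONTOUR**: `∂(p, b) ≠ 0 ⟹ b = b_m(p)` for one of the four contour bonds `edgeY p m` of (3.2) (the statement n06's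
`B9Eq3104CutoffCommutatorSizes.curlK_ne_zero_imp` proves in bond coordinates; same proof, NODE 00's numbering).
[cite: Balaban1985BackgroundPropagators, (3.2) p.390, (3.4) p.391, bookkeeping] -/
theorem exists_edgeY_eq_of_curlK_ne_zero {p : PlaqY i} {b : FBondY i} (h : curlK i p b ≠ 0) : ∃ m : Fin 4, edgeY i p m = b := by
  -- adapted from `B9Eq3104CutoffCommutatorSizes.curlK_ne_zero_imp`
  by_contra hc
  simp only [not_exists] at hc
  have h2 : (⟨p.src, p.μ⟩ : FBondY i) ≠ b := hc 2
  have h3 : (⟨p.src.shift p.μ, p.ν⟩ : FBondY i) ≠ b := hc 3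
  have h0 : (⟨p.src.shift p.ν, p.μ⟩ : FBondY i) ≠ b := hc 0
  have h1 : (⟨p.src, p.ν⟩ : FBondY i) ≠ b := hc 1
  apply h
  show LinearMap.toMatrix' (B6Ineq2133TwoScaleV1.onFun (B6SectAOperatorsV1.dcE (P := PV d ℓ i.m i.K hd hL) i.cf)) p b = 0
  rw [B6AgreeLapV1Chart.toMatrix'_dcE, if_neg h2, if_neg h3, if_neg h0, if_neg h1]
  ring

/-- The first Hessian term on a one-bond field vanishes off the contour: `((D*_U ∘ 𝒦_U ∘ D^η_U)(δ_{b′} ⊗ E))(b) = 0` when no plaquette has both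
`∂(p,b) ≠ 0` and `∂(p,b′) ≠ 0` (`∂* = ∂ᵀ`). [cite: Balaban1985BackgroundPropagators, (3.10) p.392, (3.4) p.391] -/
theorem dKd_single_eq_zero (U : CfgY 𝔸 i) (b b' : FBondY i) (E : 𝔸) (h : ∀ p, curlK i p b ≠ 0 → curlK i p b' = 0) :
    (coCurlY i U ∘ₗ jordanY i U ∘ₗ curlY i U) (Pi.single b' E) b = 0 := by
  simp only [LinearMap.comp_apply, coCurlY, trLiftY_apply]
  refine Finset.sum_eq_zero fun p _ => ?_
  by_cases hc : curlK i p b = 0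
  · rw [cocurlK_eq_transpose, Matrix.transpose_apply, hc, Complex.ofReal_zero, zero_smul]
  · rw [jordanY_apply, curlY_single_apply, h p hc, Complex.ofReal_zero, zero_smul, zero_mul, mul_zero, add_zero, smul_zero,
      R_zero, smul_zero]

/-- A primed contour variable of a one-bond field vanishes unless the bond IS that contour bond: `A′(b_l)(δ_{b′} ⊗ E) = 0` for `b_l(p) ≠ b′`.
[cite: Balaban1985BackgroundPropagators, (3.2) p.390] -/
theorem primeEdgeY_single_eq_zero (U : CfgY 𝔸 i) (p : PlaqY i) (l : Fin 4) (b' : FBondY i) (E : 𝔸) (h : edgeY i p l ≠ b') :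
    primeEdgeY i U p l (Pi.single b' E) = 0 := by
  rw [primeEdgeY_apply, Pi.single_eq_of_ne h, R_zero, smul_zero]

/-- The commutator term `Δ′₂(U)` on a one-bond field vanishes off common plaquettes: `(Δ′₂(U)(δ_{b′} ⊗ E))(b) = 0` when no plaquette has `b` and `b′`
among its contour bonds. [cite: Balaban1985BackgroundPropagators, (3.10) p.392, (3.2) p.390] -/
theorem curv2Y_single_eq_zero (U : CfgY 𝔸 i) (b b' : FBondY i) (E : 𝔸) (h : ∀ p m l, edgeY i p m = b → edgeY i p l ≠ b') :
    curv2Y i U (Pi.single b' E) b = 0 := by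
  rw [curv2Y_apply]
  refine smul_eq_zero_of_right _ (Finset.sum_eq_zero fun p _ => Finset.sum_eq_zero fun m _ => ?_)
  split_ifs with hm
  · have hS : ∀ (P : Fin 4 → Prop) [DecidablePred P],
        (∑ l : Fin 4, if P l then primeEdgeY i U p l else 0) (Pi.single b' E) = 0 := by
      intro P _
      rw [LinearMap.coe_sum, Finset.sum_apply]
      refine Finset.sum_eq_zero fun l _ => ?_
      split_ifs
      · exact primeEdgeY_single_eq_zero i U p l b' E (h p m l hm)
      · rfl
    rw [hS, hS, sub_zero, map_zero, R_zero, smul_zero]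
  · rfl

/-- ★ **LOCALITY OF THE HESSIAN `Δ(U)` (3.10)**: `(Δ(U)(δ_{b′} ⊗ E))(b) = 0` unless `b` and `b′` are contour bonds of a COMMON plaquette (both the `Re U(∂p)`-term
`D*𝒦D` and the `Im U(∂p)`-term `Δ′₂` couple only bonds of one contour). [cite: Balaban1985BackgroundPropagators, (3.10) p.392, (3.2) p.390, (3.4) p.391] -/
theorem hessY_single_eq_zero (U : CfgY 𝔸 i) (b b' : FBondY i) (E : 𝔸) (h : ∀ p m l, edgeY i p m = b → edgeY i p l ≠ b') :
    hessY i U (Pi.single b' E) b = 0 := by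
  rw [hessY_apply_eq, curv2Y_single_eq_zero i U b b' E h, add_zero]
  refine dKd_single_eq_zero i U b b' E fun p hb => ?_
  by_contra hb'
  obtain ⟨m, hm⟩ := exists_edgeY_eq_of_curlK_ne_zero i hb
  obtain ⟨l, hl⟩ := exists_edgeY_eq_of_curlK_ne_zero i hb'
  exact h p m l hm hl

/-- The covariant bond averaging of a one-bond field: `(Q(U)(δ_{b′} ⊗ E))(ι) = Q(ι,b′)·R(T_ι(b′))E`. [cite: Balaban1985BackgroundPropagators, (3.12) p.392] -/
theorem QY_single_apply (parB : BondParY 𝔸 i) (U : CfgY 𝔸 i) (b' : FBondY i) (E : 𝔸) (ι : IBondY i) :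
    QY i parB U (Pi.single b' E) ι = ((qK i ι b' : ℝ) : ℂ) • R (qT i parB U ι b') E := by
  simp only [QY, trLiftY_apply]
  rw [Finset.sum_eq_single b' (fun x _ hx => by rw [Pi.single_eq_of_ne hx, R_zero, smul_zero])
    (fun h => absurd (Finset.mem_univ _) h), Pi.single_eq_same]

/-- ★ **LOCALITY OF THE AVERAGING SANDWICH `Q*(U)aQ(U)`**: `((Q*aQ)(U)(δ_{b′} ⊗ E))(b) = 0` unless `qsK(b,ι) ≠ 0`, `aK(ι,ι′) ≠ 0`, `qK(ι′,b′) ≠ 0` for some index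
bonds `ι, ι′` (an averaging link). [cite: Balaban1985BackgroundPropagators, (3.12)–(3.13) p.392, (3.26) p.395; Balaban1984PropagatorsII, (2.19) p.226] -/
theorem QsaQ_single_eq_zero (parB : BondParY 𝔸 i) (U : CfgY 𝔸 i) (b b' : FBondY i) (E : 𝔸)
    (h : ∀ ι ι', qsK i b ι ≠ 0 → aK i ι ι' ≠ 0 → qK i ι' b' = 0) :
    (QsY i parB U ∘ₗ aY i ∘ₗ QY i parB U) (Pi.single b' E) b = 0 := by
  simp only [LinearMap.comp_apply, QsY, trLiftY_apply]
  refine Finset.sum_eq_zero fun ι _ => ?_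
  by_cases h1 : qsK i b ι = 0
  · rw [h1, Complex.ofReal_zero, zero_smul]
  · have h0 : aY i (QY i parB U (Pi.single b' E)) ι = 0 := by
      rw [aY_apply]
      refine Finset.sum_eq_zero fun ι' _ => ?_
      by_cases h2 : aK i ι ι' = 0
      · rw [h2, Complex.ofReal_zero, zero_smul]
      · rw [QY_single_apply, h ι ι' h1 h2, Complex.ofReal_zero, zero_smul, smul_zero]
    rw [h0, R_zero, smul_zero]

/-- **LOCALITY OF THE LOCAL PART `Δ(U) + Q*(U)aQ(U)` OF `Δ_a(U)`** on one-bond fields: zero off common plaquettes and averaging links.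
[cite: Balaban1985BackgroundPropagators, (3.26) p.395, (3.10) p.392, (3.12)–(3.13) p.392] -/
theorem localDeltaA_single_eq_zero (parB : BondParY 𝔸 i) (U : CfgY 𝔸 i) (b b' : FBondY i) (E : 𝔸)
    (hp : ∀ p m l, edgeY i p m = b → edgeY i p l ≠ b') (hq : ∀ ι ι', qsK i b ι ≠ 0 → aK i ι ι' ≠ 0 → qK i ι' b' = 0) :
    hessY i U (Pi.single b' E) b + (QsY i parB U ∘ₗ aY i ∘ₗ QY i parB U) (Pi.single b' E) b = 0 := by
  rw [hessY_single_eq_zero i U b b' E hp, QsaQ_single_eq_zero i parB U b b' E hq, add_zero]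

end Locality

/-! ## §2. The range read through a bond reading into [13]'s unit torus -/

section Range

variable [DecidableEq (FBondY i)]
variable {ν : ℕ} {Nf : Fin ν → ℕ} [∀ j, NeZero (Nf j)]

omit [DecidableEq (FBondY i)] in
/-- **THE AVERAGING-LINK NUMERAL FROM THREE READINGS**: if `qsK(b,ι) ≠ 0` reads as `d₁(ℓB b, ℓI ι) ≤ s₁`, `aK(ι,ι′) ≠ 0` as `d₁(ℓI ι, ℓI ι′) ≤ s₂` and
`qK(ι′,b′) ≠ 0` as `d₁(ℓI ι′, ℓB b′) ≤ s₁` (NODE 00's dictionary: the block size and the weight's range), then an averaging link reads as `≤ s₁ + s₂ + s₁`.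
[cite: Balaban1985BackgroundPropagators, (3.12)–(3.13) p.392, (3.26) p.395; Balaban1984PropagatorsII, (2.19) p.226; Balaban1988RG2Cluster, (2.5) p.12] -/
theorem linkReading_of_readings (ℓB : FBondY i → UT Nf) (ℓI : IBondY i → UT Nf) {s₁ s₂ : ℝ}
    (hQs : ∀ b ι, qsK i b ι ≠ 0 → tdist1 Nf (ℓB b) (ℓI ι) ≤ s₁) (ha : ∀ ι ι', aK i ι ι' ≠ 0 → tdist1 Nf (ℓI ι) (ℓI ι') ≤ s₂)
    (hQ : ∀ ι b, qK i ι b ≠ 0 → tdist1 Nf (ℓI ι) (ℓB b) ≤ s₁) :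
    ∀ b ι ι' b', qsK i b ι ≠ 0 → aK i ι ι' ≠ 0 → qK i ι' b' ≠ 0 → tdist1 Nf (ℓB b) (ℓB b') ≤ s₁ + s₂ + s₁ := by
  intro b ι ι' b' h1 h2 h3
  calc tdist1 Nf (ℓB b) (ℓB b') ≤ tdist1 Nf (ℓB b) (ℓI ι') + tdist1 Nf (ℓI ι') (ℓB b') := tdist1_triangle _ _ _
    _ ≤ tdist1 Nf (ℓB b) (ℓI ι) + tdist1 Nf (ℓI ι) (ℓI ι') + tdist1 Nf (ℓI ι') (ℓB b') :=
        add_le_add (tdist1_triangle _ _ _) le_rfl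
    _ ≤ s₁ + s₂ + s₁ := add_le_add (add_le_add (hQs b ι h1) (ha ι ι' h2)) (hQ ι' b' h3)

/-- **THE RANGE OF `Δ(U)` THROUGH A BOND READING** `ℓB : FBondY i → UT Nf`: if a plaquette's contour reads as `ℓB`-diameter `≤ s` (one displayed numeral), then
`(Δ(U)(δ_{b′} ⊗ E))(b) ≠ 0 ⇒ d₁(ℓB b, ℓB b′) ≤ s`. [cite: Balaban1985BackgroundPropagators, (3.10) p.392, (3.107)–(3.108) p.416; Balaban1988RG2Cluster, (2.5) p.12] -/
theorem tdist_le_of_hessY_single_ne_zero (ℓB : FBondY i → UT Nf) {s : ℝ}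
    (hℓp : ∀ p m l, tdist1 Nf (ℓB (edgeY i p m)) (ℓB (edgeY i p l)) ≤ s)
    {U : CfgY 𝔸 i} {b b' : FBondY i} {E : 𝔸} (h : hessY i U (Pi.single b' E) b ≠ 0) :
    tdist1 Nf (ℓB b) (ℓB b') ≤ s := by
  by_contra hlt
  refine h (hessY_single_eq_zero i U b b' E fun p m l hm hl => hlt ?_)
  rw [← hm, ← hl]
  exact hℓp p m l

/-- **THE RANGE OF `Q*(U)aQ(U)` THROUGH A BOND READING**: if an averaging link reads as `≤ s` (one displayed numeral; `linkReading_of_readings`), then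
`((Q*aQ)(U)(δ_{b′} ⊗ E))(b) ≠ 0 ⇒ d₁(ℓB b, ℓB b′) ≤ s`. [cite: Balaban1985BackgroundPropagators, (3.12)–(3.13) p.392, (3.26) p.395, (3.108) p.416; Balaban1988RG2Cluster, (2.5) p.12] -/
theorem tdist_le_of_QsaQ_single_ne_zero (ℓB : FBondY i → UT Nf) {s : ℝ}
    (hℓq : ∀ b ι ι' b', qsK i b ι ≠ 0 → aK i ι ι' ≠ 0 → qK i ι' b' ≠ 0 → tdist1 Nf (ℓB b) (ℓB b') ≤ s)
    {parB : BondParY 𝔸 i} {U : CfgY 𝔸 i} {b b' : FBondY i} {E : 𝔸} (h : (QsY i parB U ∘ₗ aY i ∘ₗ QY i parB U) (Pi.single b' E) b ≠ 0) :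
    tdist1 Nf (ℓB b) (ℓB b') ≤ s := by
  by_contra hlt
  refine h (QsaQ_single_eq_zero i parB U b b' E fun ι ι' h1 h2 => ?_)
  by_contra h3
  exact hlt (hℓq b ι ι' b' h1 h2 h3)

/-- ★ **THE RANGE OF THE LOCAL PART OF `Δ_a(U)` THROUGH A BOND READING**: with the two numerals of the previous lemmas (same `s`),
`(Δ(U)(δ_{b′} ⊗ E))(b) + ((Q*aQ)(U)(δ_{b′} ⊗ E))(b) ≠ 0 ⇒ d₁(ℓB b, ℓB b′) ≤ s`.
[cite: Balaban1985BackgroundPropagators, (3.26) p.395, (3.107)–(3.108) p.416; Balaban1988RG2Cluster, (2.5) p.12, p.15] -/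
theorem tdist_le_of_localDeltaA_single_ne_zero (ℓB : FBondY i → UT Nf) {s : ℝ}
    (hℓp : ∀ p m l, tdist1 Nf (ℓB (edgeY i p m)) (ℓB (edgeY i p l)) ≤ s)
    (hℓq : ∀ b ι ι' b', qsK i b ι ≠ 0 → aK i ι ι' ≠ 0 → qK i ι' b' ≠ 0 → tdist1 Nf (ℓB b) (ℓB b') ≤ s)
    {parB : BondParY 𝔸 i} {U : CfgY 𝔸 i} {b b' : FBondY i} {E : 𝔸}
    (h : hessY i U (Pi.single b' E) b + (QsY i parB U ∘ₗ aY i ∘ₗ QY i parB U) (Pi.single b' E) b ≠ 0) :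
    tdist1 Nf (ℓB b) (ℓB b') ≤ s := by
  by_cases h1 : hessY i U (Pi.single b' E) b = 0
  · rw [h1, zero_add] at h
    exact tdist_le_of_QsaQ_single_ne_zero i ℓB hℓq h
  · exact tdist_le_of_hessY_single_ne_zero i ℓB hℓp h1

end Range

/-! ## §3. The coordinates of the local part along the pencil -/

section Coordinates

variable (U₀ : CfgY 𝔸 i) (η : ℝ) {Rc : ℝ}

/-- **THE COORDINATES OF THE LOCAL PART OF `Δ_a` ALONG THE PENCIL ARE HOLOMORPHIC**: `A′ ↦ φ((Δ(U)Λ)(b) + ((Q*aQ)(U)Λ)(b))` at `U = e^{iηA′}U₀` for every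
continuous linear `φ : 𝔸 → ℂ` (75 `differentiableOn_localDeltaA_prodCfg` through `φ`). [cite: Balaban1985BackgroundPropagators, (3.26) p.395, Thm 3.4 and (3.50) p.400] -/
theorem differentiableOn_coord_localDeltaA_prodCfg (φ : 𝔸 →L[ℂ] ℂ) (Λ : FBondY i → 𝔸) (b : FBondY i) :
    DifferentiableOn ℂ (fun a => φ (hessY i (prodCfg U₀ η a) Λ b +
        (QsY i (parBY i) (prodCfg U₀ η a) ∘ₗ aY i ∘ₗ QY i (parBY i) (prodCfg U₀ η a)) Λ b))
      (ball (0 : Fin (d + 1) → Site (PV d ℓ i.m i.K hd hL) 0 → 𝔸) Rc) :=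
  φ.differentiable.comp_differentiableOn (differentiableOn_localDeltaA_prodCfg i U₀ η Λ b)

end Coordinates

/-! ## §4. ★★ The square `RawEntryLetters` packaging of the local part along the pencil -/

section Packaging

variable [NormOneClass 𝔸]
variable {ν : ℕ} {Nf : Fin ν → ℕ} [∀ j, NeZero (Nf j)]
variable {κ : Type} [Fintype κ] [DecidableEq κ] (b : Basis κ ℂ 𝔸)
variable (U₀ : CfgY 𝔸 i) (η : ℝ) {Rc K₀ : ℝ} {D : ℕ}

open Classical in
/-- ★★ **THE LOCAL PART `Δ(U) + Q*(U)aQ(U)` OF `Δ_a` ALONG THE PENCIL AS AN N10 LETTER DATUM** (square case, index `FBondY i × κ`, locations `(b,k) ↦ ℓB b`): for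
EVERY `ρ ≥ 0`, `RawEntryLetters (A′ ↦ toMatrix B′ B′ (Δ(e^{iηA′}U₀) + (Q*aQ)(e^{iηA′}U₀))) (ℓB ∘ fst) Rc ρ (cb·M·e^{ρs})` with `M` = 75's majorant
(`norm_localDeltaA_prodCfg_le`) at `‖Λ‖ = cl`.  Inputs: the background's size (`‖U₀(b)^{±1}‖ ≤ K₀`, `1 ≤ K₀`), `0 ≤ Rc`, the curl ∕ co-curl row sums `c₁, c₂ ≥ 0`,
the contour incidence count `N_b ≥ 0`, the averaging support-length numeral `D` and row sums `c_Q, c_{Q*}, c_a ≥ 0`, the basis numerals `cb, cl ≥ 0`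
(`‖b.repr a k‖ ≤ cb‖a‖`, `‖b_l‖ ≤ cl`), the reading numeral `s` of §2.  Holomorphy: §3 at `φ := (b.coord k).mkContinuous cb`; bound: 75; range: §2; packaging: 56A
`rawEntryLetters_of_range_family` + `B13InverseOperatorCoordinates.rawEntryLetters_toMatrix_of_coordFamily` (no finite-dimension instance assumed).
[cite: Balaban1985BackgroundPropagators, (3.26) p.395, (3.10) p.392, Thm 3.4 and (3.50) p.400, Thm 3.10 (3.107)–(3.108) p.416; Balaban1988RG2Cluster, (2.5) p.12, p.15] -/
theorem rawEntryLetters_toMatrix_localDeltaA_prodCfg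
    (hU : ∀ μ x, ‖(U₀ μ x : 𝔸)‖ ≤ K₀) (hUi : ∀ μ x, ‖(((U₀ μ x)⁻¹ : 𝔸ˣ) : 𝔸)‖ ≤ K₀) (hK1 : 1 ≤ K₀) (hRc : 0 ≤ Rc)
    {c₁ c₂ : ℝ} (hc₀ : 0 ≤ c₁) (hc₂0 : 0 ≤ c₂) (hc₁ : ∀ p, ∑ b, |curlK i p b| ≤ c₁) (hc₂ : ∀ b, ∑ p, |cocurlK i b p| ≤ c₂)
    {Nb : ℝ} (hNb0 : 0 ≤ Nb)
    (hNb : ∀ b : FBondY i,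
      ((((Finset.univ : Finset (PlaqY i)) ×ˢ (Finset.univ : Finset (Fin 4))).filter fun pm => edgeY i pm.1 pm.2 = b).card : ℝ) ≤ Nb)
    (hD : ∀ ι b, qK i ι b ≠ 0 → Site.tdist (embIter (ι.1.1 : ℕ) ι.1.2.src) b.src ≤ D)
    (hD' : ∀ b ι, qsK i b ι ≠ 0 → Site.tdist (embIter (ι.1.1 : ℕ) ι.1.2.src) b.src ≤ D)
    {cQ cQs ca : ℝ} (hcQ0 : 0 ≤ cQ) (hcQs0 : 0 ≤ cQs) (hca0 : 0 ≤ ca) (hcQ : ∀ ι, ∑ b, |qK i ι b| ≤ cQ) (hcQs : ∀ b, ∑ ι, |qsK i b ι| ≤ cQs)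
    (hca : ∀ ι, ∑ ι', |aK i ι ι'| ≤ ca)
    {cb cl : ℝ} (hcb : ∀ (a : 𝔸) (k : κ), ‖b.repr a k‖ ≤ cb * ‖a‖) (hcb0 : 0 ≤ cb) (hcl : ∀ l, ‖b l‖ ≤ cl) (hcl0 : 0 ≤ cl)
    (ℓB : FBondY i → UT Nf) {s : ℝ}
    (hℓp : ∀ p m l, tdist1 Nf (ℓB (edgeY i p m)) (ℓB (edgeY i p l)) ≤ s)
    (hℓq : ∀ b ι ι' b', qsK i b ι ≠ 0 → aK i ι ι' ≠ 0 → qK i ι' b' ≠ 0 → tdist1 Nf (ℓB b) (ℓB b') ≤ s)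
    {ρ : ℝ} (hρ : 0 ≤ ρ) :
    RawEntryLetters (fun a : Fin (d + 1) → Site (PV d ℓ i.m i.K hd hL) 0 → 𝔸 =>
        LinearMap.toMatrix ((Pi.basis fun _ : FBondY i => b).reindex (Equiv.sigmaEquivProd (FBondY i) κ))
          ((Pi.basis fun _ : FBondY i => b).reindex (Equiv.sigmaEquivProd (FBondY i) κ))
          (hessY i (prodCfg U₀ η a) + QsY i (parBY i) (prodCfg U₀ η a) ∘ₗ aY i ∘ₗ QY i (parBY i) (prodCfg U₀ η a)))
      (fun p : FBondY i × κ => ℓB p.1) Rc ρ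
      (cb * ((c₂ * (K₀ * Real.exp (|η| * Rc) *
          ((K₀ * Real.exp (|η| * Rc)) ^ 4 * (c₁ * (K₀ * Real.exp (|η| * Rc) * cl * (K₀ * Real.exp (|η| * Rc))))) *
          (K₀ * Real.exp (|η| * Rc))) +
        1 / 2 * (Nb * (K₀ * Real.exp (|η| * Rc) *
          (2 * (i.cf ^ 2 * (K₀ * Real.exp (|η| * Rc)) ^ 4) * (8 * (K₀ * Real.exp (|η| * Rc) * cl * (K₀ * Real.exp (|η| * Rc))))) *
          (K₀ * Real.exp (|η| * Rc))))) +
      cQs * ((K₀ * Real.exp (|η| * Rc)) ^ D *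
        (ca * (cQ * ((K₀ * Real.exp (|η| * Rc)) ^ D * cl * (K₀ * Real.exp (|η| * Rc)) ^ D))) * (K₀ * Real.exp (|η| * Rc)) ^ D)) * Real.exp (ρ * s)) := by
  -- the coordinate functionals as continuous linear maps, from the numeral `cb`
  set φ : κ → 𝔸 →L[ℂ] ℂ := fun k => (b.coord k).mkContinuous cb (fun a => by rw [Basis.coord_apply]; exact hcb a k) with hφ
  have hφapp : ∀ k (a : 𝔸), φ k a = b.coord k a := fun k a => LinearMap.mkContinuous_apply _ _ _ _
  set Kη : ℝ := K₀ * Real.exp (|η| * Rc) with hKη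
  have hK0 : 0 ≤ K₀ := zero_le_one.trans hK1
  have hKη0 : 0 ≤ Kη := mul_nonneg hK0 (Real.exp_nonneg _)
  -- 75's majorant is linear in `‖Λ‖`: factor it
  have eP : ∀ t : ℝ, (c₂ * (Kη * (Kη ^ 4 * (c₁ * (Kη * t * Kη))) * Kη) + 1 / 2 * (Nb * (Kη * (2 * (i.cf ^ 2 * Kη ^ 4) * (8 * (Kη * t * Kη))) * Kη))) +
        cQs * (Kη ^ D * (ca * (cQ * (Kη ^ D * t * Kη ^ D))) * Kη ^ D) =
      t * (c₂ * c₁ * Kη ^ 8 + 8 * (Nb * i.cf ^ 2) * Kη ^ 8 + cQs * ca * cQ * (Kη ^ D * Kη ^ D * (Kη ^ D * Kη ^ D))) := by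
    intro t; ring
  have hA : 0 ≤ c₂ * c₁ * Kη ^ 8 + 8 * (Nb * i.cf ^ 2) * Kη ^ 8 + cQs * ca * cQ * (Kη ^ D * Kη ^ D * (Kη ^ D * Kη ^ D)) := by
    have h8 : 0 ≤ Kη ^ 8 := pow_nonneg hKη0 _
    have hDD : 0 ≤ Kη ^ D * Kη ^ D * (Kη ^ D * Kη ^ D) :=
      mul_nonneg (mul_nonneg (pow_nonneg hKη0 _) (pow_nonneg hKη0 _)) (mul_nonneg (pow_nonneg hKη0 _) (pow_nonneg hKη0 _))
    exact add_nonneg (add_nonneg (mul_nonneg (mul_nonneg hc₂0 hc₀) h8) (mul_nonneg (mul_nonneg (by norm_num) (mul_nonneg hNb0 (sq_nonneg _))) h8))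
      (mul_nonneg (mul_nonneg (mul_nonneg hcQs0 hca0) hcQ0) hDD)
  have hM0 : 0 ≤ (c₂ * (Kη * (Kη ^ 4 * (c₁ * (Kη * cl * Kη))) * Kη) + 1 / 2 * (Nb * (Kη * (2 * (i.cf ^ 2 * Kη ^ 4) * (8 * (Kη * cl * Kη))) * Kη))) +
      cQs * (Kη ^ D * (ca * (cQ * (Kη ^ D * cl * Kη ^ D))) * Kη ^ D) := by
    rw [eP]; exact mul_nonneg hcl0 hA
  refine rawEntryLetters_toMatrix_of_coordFamily b
    (fun a => hessY i (prodCfg U₀ η a) + QsY i (parBY i) (prodCfg U₀ η a) ∘ₗ aY i ∘ₗ QY i (parBY i) (prodCfg U₀ η a)) ?_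
  refine rawEntryLetters_of_range_family (fun p q => ?_) hρ (mul_nonneg hcb0 hM0) (fun u _ p q hne => ?_) (fun u hu p q => ?_)
  · -- holomorphy: §3 at `φ_k := (b.coord k).mkContinuous cb`
    exact (differentiableOn_coord_localDeltaA_prodCfg i U₀ η (φ p.2) (Pi.single q.1 (b q.2)) p.1).congr fun u _ => (hφapp p.2 _).symm
  · -- range: §2
    simp only [LinearMap.add_apply, Pi.add_apply] at hne
    refine tdist_le_of_localDeltaA_single_ne_zero i ℓB hℓp hℓq (parB := parBY i) (U := prodCfg U₀ η u) (E := b q.2) fun h0 => hne ?_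
    rw [h0, map_zero]
  · -- bound: `cb` × 75's majorant at `‖Λ‖ = ‖δ_{b′} ⊗ b_l‖ = ‖b_l‖ ≤ cl`
    have hΛ : ‖(Pi.single q.1 (b q.2) : FBondY i → 𝔸)‖ ≤ cl := by rw [Pi.norm_single]; exact hcl q.2
    have h75 := norm_localDeltaA_prodCfg_le i U₀ η hU hUi hK1 hRc hc₀ hc₁ hc₂ p.1 (hNb p.1) hD hD' hcQ0 hca0 hcQ hcQs hca
      (Pi.single q.1 (b q.2)) hu
    have hmono : (c₂ * (Kη * (Kη ^ 4 * (c₁ * (Kη * ‖(Pi.single q.1 (b q.2) : FBondY i → 𝔸)‖ * Kη))) * Kη) +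
          1 / 2 * (Nb * (Kη * (2 * (i.cf ^ 2 * Kη ^ 4) * (8 * (Kη * ‖(Pi.single q.1 (b q.2) : FBondY i → 𝔸)‖ * Kη))) * Kη))) +
        cQs * (Kη ^ D * (ca * (cQ * (Kη ^ D * ‖(Pi.single q.1 (b q.2) : FBondY i → 𝔸)‖ * Kη ^ D))) * Kη ^ D) ≤
        (c₂ * (Kη * (Kη ^ 4 * (c₁ * (Kη * cl * Kη))) * Kη) + 1 / 2 * (Nb * (Kη * (2 * (i.cf ^ 2 * Kη ^ 4) * (8 * (Kη * cl * Kη))) * Kη))) +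
          cQs * (Kη ^ D * (ca * (cQ * (Kη ^ D * cl * Kη ^ D))) * Kη ^ D) := by
      rw [eP, eP]
      exact mul_le_mul_of_nonneg_right hΛ hA
    calc ‖b.coord p.2 ((hessY i (prodCfg U₀ η u) + QsY i (parBY i) (prodCfg U₀ η u) ∘ₗ aY i ∘ₗ QY i (parBY i) (prodCfg U₀ η u))
            (Pi.single q.1 (b q.2)) p.1)‖
        ≤ cb * ‖hessY i (prodCfg U₀ η u) (Pi.single q.1 (b q.2)) p.1 +
            (QsY i (parBY i) (prodCfg U₀ η u) ∘ₗ aY i ∘ₗ QY i (parBY i) (prodCfg U₀ η u)) (Pi.single q.1 (b q.2)) p.1‖ := by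
          rw [Basis.coord_apply]; exact hcb _ _
      _ ≤ cb * ((c₂ * (Kη * (Kη ^ 4 * (c₁ * (Kη * cl * Kη))) * Kη) +
            1 / 2 * (Nb * (Kη * (2 * (i.cf ^ 2 * Kη ^ 4) * (8 * (Kη * cl * Kη))) * Kη))) +
          cQs * (Kη ^ D * (ca * (cQ * (Kη ^ D * cl * Kη ^ D))) * Kη ^ D)) :=
          mul_le_mul_of_nonneg_left (h75.trans hmono) hcb0

end Packaging

/-! ## §5. ★★ The `Δ_a` socket: local part + the projection term's displayed letters -/

section DeltaA

variable [NormOneClass 𝔸]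
variable {ν : ℕ} {Nf : Fin ν → ℕ} [∀ j, NeZero (Nf j)]
variable {κ : Type} [Fintype κ] [DecidableEq κ] (b : Basis κ ℂ 𝔸)
variable (parS : SiteParY 𝔸 i) (Gp : SiteOpY 𝔸 i) (U₀ : CfgY 𝔸 i) (η : ℝ) {Rc K₀ : ℝ} {D : ℕ}

omit [NormOneClass 𝔸] in
open Classical in
/-- NODE 00's `Δ_a(U)` in a product basis: `toMatrix (Δ_a(U)) = toMatrix (Δ(U) + Q*(U)aQ(U)) + toMatrix (D_U R(U) D*_U)` (definition `deltaAY = hessY + gradY ∘ RY ∘ divY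
+ QsY ∘ aY ∘ QY`, additivity of `LinearMap.toMatrix`). [cite: Balaban1985BackgroundPropagators, (3.26) p.395, dictionary] -/
theorem toMatrix_deltaAY_eq_add (parB : BondParY 𝔸 i) (U : CfgY 𝔸 i) :
    LinearMap.toMatrix ((Pi.basis fun _ : FBondY i => b).reindex (Equiv.sigmaEquivProd (FBondY i) κ))
        ((Pi.basis fun _ : FBondY i => b).reindex (Equiv.sigmaEquivProd (FBondY i) κ)) (deltaAY i parS parB Gp U) =
      LinearMap.toMatrix ((Pi.basis fun _ : FBondY i => b).reindex (Equiv.sigmaEquivProd (FBondY i) κ))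
          ((Pi.basis fun _ : FBondY i => b).reindex (Equiv.sigmaEquivProd (FBondY i) κ)) (hessY i U + QsY i parB U ∘ₗ aY i ∘ₗ QY i parB U) +
        LinearMap.toMatrix ((Pi.basis fun _ : FBondY i => b).reindex (Equiv.sigmaEquivProd (FBondY i) κ))
          ((Pi.basis fun _ : FBondY i => b).reindex (Equiv.sigmaEquivProd (FBondY i) κ)) (gradY i U ∘ₗ RY i parS Gp U ∘ₗ divY i U) := by
  rw [← map_add, add_right_comm]
  rfl

open Classical in
/-- ★★ **THE `Δ_a` SOCKET**: the letters of `A′ ↦ toMatrix B′ B′ (Δ_a(e^{iηA′}U₀))` (`parB := parBY`, any `parS`, any `G′`-letter `Gp`) from §4 (the local part,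
numerals of NODE 00) and ONE DISPLAYED letter datum `B_P` at the same `(Rc, ρ)` for the projection term `A′ ↦ toMatrix B′ B′ ((D_U R(U) D*_U)(e^{iηA′}U₀))`
(`R(U) = I − G′Q′*(Q′G′²Q′*)⁻¹Q′G′` (3.25) — the inverse road's: G′-junction, X-station, X⁻¹-junction, …); constant `cb·M·e^{ρs} + B_P` (34 `rawEntryLetters_add`).
This is EXACTLY input (i) of `B13InverseOperatorCoordinates.rawEntryLetters_toMatrix_GAY_prodCfg_located`.
[cite: Balaban1985BackgroundPropagators, (3.25)–(3.26) pp.394–395, Thm 3.4 and (3.50) p.400, (3.108) p.416; Balaban1988RG2Cluster, (2.5) p.12, p.15; Balaban1984PropagatorsII, p.232] -/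
theorem rawEntryLetters_toMatrix_deltaAY_prodCfg_of_projection
    (hU : ∀ μ x, ‖(U₀ μ x : 𝔸)‖ ≤ K₀) (hUi : ∀ μ x, ‖(((U₀ μ x)⁻¹ : 𝔸ˣ) : 𝔸)‖ ≤ K₀) (hK1 : 1 ≤ K₀) (hRc : 0 ≤ Rc)
    {c₁ c₂ : ℝ} (hc₀ : 0 ≤ c₁) (hc₂0 : 0 ≤ c₂) (hc₁ : ∀ p, ∑ b, |curlK i p b| ≤ c₁) (hc₂ : ∀ b, ∑ p, |cocurlK i b p| ≤ c₂)
    {Nb : ℝ} (hNb0 : 0 ≤ Nb)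
    (hNb : ∀ b : FBondY i,
      ((((Finset.univ : Finset (PlaqY i)) ×ˢ (Finset.univ : Finset (Fin 4))).filter fun pm => edgeY i pm.1 pm.2 = b).card : ℝ) ≤ Nb)
    (hD : ∀ ι b, qK i ι b ≠ 0 → Site.tdist (embIter (ι.1.1 : ℕ) ι.1.2.src) b.src ≤ D)
    (hD' : ∀ b ι, qsK i b ι ≠ 0 → Site.tdist (embIter (ι.1.1 : ℕ) ι.1.2.src) b.src ≤ D)
    {cQ cQs ca : ℝ} (hcQ0 : 0 ≤ cQ) (hcQs0 : 0 ≤ cQs) (hca0 : 0 ≤ ca) (hcQ : ∀ ι, ∑ b, |qK i ι b| ≤ cQ) (hcQs : ∀ b, ∑ ι, |qsK i b ι| ≤ cQs)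
    (hca : ∀ ι, ∑ ι', |aK i ι ι'| ≤ ca)
    {cb cl : ℝ} (hcb : ∀ (a : 𝔸) (k : κ), ‖b.repr a k‖ ≤ cb * ‖a‖) (hcb0 : 0 ≤ cb) (hcl : ∀ l, ‖b l‖ ≤ cl) (hcl0 : 0 ≤ cl)
    (ℓB : FBondY i → UT Nf) {s : ℝ}
    (hℓp : ∀ p m l, tdist1 Nf (ℓB (edgeY i p m)) (ℓB (edgeY i p l)) ≤ s)
    (hℓq : ∀ b ι ι' b', qsK i b ι ≠ 0 → aK i ι ι' ≠ 0 → qK i ι' b' ≠ 0 → tdist1 Nf (ℓB b) (ℓB b') ≤ s)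
    {ρ : ℝ} (hρ : 0 ≤ ρ)
    -- the projection term's letters along the pencil (the inverse road's content), displayed
    {BP : ℝ}
    (hP : RawEntryLetters (fun a : Fin (d + 1) → Site (PV d ℓ i.m i.K hd hL) 0 → 𝔸 =>
        LinearMap.toMatrix ((Pi.basis fun _ : FBondY i => b).reindex (Equiv.sigmaEquivProd (FBondY i) κ))
          ((Pi.basis fun _ : FBondY i => b).reindex (Equiv.sigmaEquivProd (FBondY i) κ))
          (gradY i (prodCfg U₀ η a) ∘ₗ RY i parS Gp (prodCfg U₀ η a) ∘ₗ divY i (prodCfg U₀ η a)))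
      (fun p : FBondY i × κ => ℓB p.1) Rc ρ BP) :
    RawEntryLetters (fun a : Fin (d + 1) → Site (PV d ℓ i.m i.K hd hL) 0 → 𝔸 =>
        LinearMap.toMatrix ((Pi.basis fun _ : FBondY i => b).reindex (Equiv.sigmaEquivProd (FBondY i) κ))
          ((Pi.basis fun _ : FBondY i => b).reindex (Equiv.sigmaEquivProd (FBondY i) κ)) (deltaAY i parS (parBY i) Gp (prodCfg U₀ η a)))
      (fun p : FBondY i × κ => ℓB p.1) Rc ρ
      (cb * ((c₂ * (K₀ * Real.exp (|η| * Rc) *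
          ((K₀ * Real.exp (|η| * Rc)) ^ 4 * (c₁ * (K₀ * Real.exp (|η| * Rc) * cl * (K₀ * Real.exp (|η| * Rc))))) *
          (K₀ * Real.exp (|η| * Rc))) +
        1 / 2 * (Nb * (K₀ * Real.exp (|η| * Rc) *
          (2 * (i.cf ^ 2 * (K₀ * Real.exp (|η| * Rc)) ^ 4) * (8 * (K₀ * Real.exp (|η| * Rc) * cl * (K₀ * Real.exp (|η| * Rc))))) *
          (K₀ * Real.exp (|η| * Rc))))) +
      cQs * ((K₀ * Real.exp (|η| * Rc)) ^ D *
        (ca * (cQ * ((K₀ * Real.exp (|η| * Rc)) ^ D * cl * (K₀ * Real.exp (|η| * Rc)) ^ D))) * (K₀ * Real.exp (|η| * Rc)) ^ D)) * Real.exp (ρ * s) + BP) := by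
  have h4 := rawEntryLetters_toMatrix_localDeltaA_prodCfg i b U₀ η hU hUi hK1 hRc hc₀ hc₂0 hc₁ hc₂ hNb0 hNb hD hD' hcQ0 hcQs0 hca0 hcQ hcQs hca
    hcb hcb0 hcl hcl0 ℓB hℓp hℓq hρ
  refine rawEntryLetters_congr (rawEntryLetters_add h4 hP) fun a _ => ?_
  exact toMatrix_deltaAY_eq_add i b parS Gp (parBY i) (prodCfg U₀ η a)

end DeltaA

/-! ## §6. ★★★ THE G-JUNCTION MODULO THE PROJECTION TERM: `G(e^{iηA′}U₀)` in N10 coordinates -/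

section Green

variable [NormOneClass 𝔸]
variable {ν : ℕ} {Nf : Fin ν → ℕ} [∀ j, NeZero (Nf j)]
variable {κ : Type} [Fintype κ] [DecidableEq κ] (b : Basis κ ℂ 𝔸)
variable (parS : SiteParY 𝔸 i) (Gp : SiteOpY 𝔸 i) (U₀ : CfgY 𝔸 i) (η : ℝ) {Rc K₀ : ℝ} {D : ℕ}

open Classical in
/-- ★★★ **THE G-JUNCTION MODULO ONE OPERATOR-SIDE DATUM — SECT. B's (3.84)–(3.86) FOR `G = Δ_a⁻¹` AT NODE 00's OBJECTS OF RECORD.**  Along pv27's pencil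
`A′ ↦ e^{iηA′}U₀`, the matrices of NODE 00's propagator `G(U) = Δ_a(U)⁻¹` (`Node00.GAY i parS parBY Gp`) in the product basis have the N10 letters
`RawEntryLetters (A′ ↦ toMatrix B′ B′ (G(e^{iηA′}U₀))) (ℓB ∘ fst) R₁⋆ ρ′ (2·cb·cl·B_G)` at the located thin radius
`R₁⋆ = Rc ∕ (4·B_Δ·(cb·cl·B_G)·(m·c₀(1,(ρ−ρ′)∕3)^ν)² + 1)` (`B_Δ` = §5's constant), for every target rate `0 ≤ ρ′ < ρ`.  DISPLAYED INPUTS ONLY: (the inverse road)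
the projection term's pencil letters `B_P` at `(Rc, ρ)`; (N06, GAPS G-B9-05∕06a∕07) `IsUnit (Δ_a(U₀))` and Theorem 3.3 ∕ 3.10's pointwise (3.108)-type bound
`‖G(U₀)(δ_{b′} ⊗ E)(b)‖ ≤ B_G‖E‖e^{−ρ d(ℓB b, ℓB b′)}` at the ONE real background `U₀`; (NODE 00) `K₀`, the curl ∕ averaging numerals `c₁ c₂ N_b D c_Q c_{Q*} c_a`, the
reading numeral `s`; the basis numerals `cb, cl`; a fibre bound `m` of `ℓB`; `0 < Rc`.  No rate loss `μ`, no radius `R₁`, no smallness binder, no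
complexification hypothesis.
[cite: Balaban1985BackgroundPropagators, (3.26)–(3.27) p.395, Thm 3.4 and (3.50) p.400, (3.84)–(3.86) p.407, Thm 3.10 (3.107)–(3.108) p.416; Balaban1988RG2Cluster,
(2.5)–(2.7) pp.12–13, p.15; Balaban1984PropagatorsII, Lemma 2.1 (2.61) p.234] -/
theorem rawEntryLetters_toMatrix_GAY_prodCfg_of_projection
    (hU : ∀ μ x, ‖(U₀ μ x : 𝔸)‖ ≤ K₀) (hUi : ∀ μ x, ‖(((U₀ μ x)⁻¹ : 𝔸ˣ) : 𝔸)‖ ≤ K₀) (hK1 : 1 ≤ K₀) (hRc : 0 < Rc)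
    {c₁ c₂ : ℝ} (hc₀ : 0 ≤ c₁) (hc₂0 : 0 ≤ c₂) (hc₁ : ∀ p, ∑ b, |curlK i p b| ≤ c₁) (hc₂ : ∀ b, ∑ p, |cocurlK i b p| ≤ c₂)
    {Nb : ℝ} (hNb0 : 0 ≤ Nb)
    (hNb : ∀ b : FBondY i,
      ((((Finset.univ : Finset (PlaqY i)) ×ˢ (Finset.univ : Finset (Fin 4))).filter fun pm => edgeY i pm.1 pm.2 = b).card : ℝ) ≤ Nb)
    (hD : ∀ ι b, qK i ι b ≠ 0 → Site.tdist (embIter (ι.1.1 : ℕ) ι.1.2.src) b.src ≤ D)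
    (hD' : ∀ b ι, qsK i b ι ≠ 0 → Site.tdist (embIter (ι.1.1 : ℕ) ι.1.2.src) b.src ≤ D)
    {cQ cQs ca : ℝ} (hcQ0 : 0 ≤ cQ) (hcQs0 : 0 ≤ cQs) (hca0 : 0 ≤ ca) (hcQ : ∀ ι, ∑ b, |qK i ι b| ≤ cQ) (hcQs : ∀ b, ∑ ι, |qsK i b ι| ≤ cQs)
    (hca : ∀ ι, ∑ ι', |aK i ι ι'| ≤ ca)
    {cb cl : ℝ} (hcb : ∀ (a : 𝔸) (k : κ), ‖b.repr a k‖ ≤ cb * ‖a‖) (hcb0 : 0 ≤ cb) (hcl : ∀ l, ‖b l‖ ≤ cl) (hcl0 : 0 ≤ cl)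
    (ℓB : FBondY i → UT Nf) {s : ℝ}
    (hℓp : ∀ p m l, tdist1 Nf (ℓB (edgeY i p m)) (ℓB (edgeY i p l)) ≤ s)
    (hℓq : ∀ b ι ι' b', qsK i b ι ≠ 0 → aK i ι ι' ≠ 0 → qK i ι' b' ≠ 0 → tdist1 Nf (ℓB b) (ℓB b') ≤ s)
    {m : ℕ} (hfib : ∀ y : UT Nf, (univ.filter fun p : FBondY i × κ => ℓB p.1 = y).card ≤ m)
    {ρ : ℝ} (hρ : 0 ≤ ρ)
    -- the inverse road's content: the projection term's letters along the pencil
    {BP : ℝ}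
    (hP : RawEntryLetters (fun a : Fin (d + 1) → Site (PV d ℓ i.m i.K hd hL) 0 → 𝔸 =>
        LinearMap.toMatrix ((Pi.basis fun _ : FBondY i => b).reindex (Equiv.sigmaEquivProd (FBondY i) κ))
          ((Pi.basis fun _ : FBondY i => b).reindex (Equiv.sigmaEquivProd (FBondY i) κ))
          (gradY i (prodCfg U₀ η a) ∘ₗ RY i parS Gp (prodCfg U₀ η a) ∘ₗ divY i (prodCfg U₀ η a)))
      (fun p : FBondY i × κ => ℓB p.1) Rc ρ BP)
    -- N06's content at the ONE real background `U₀`: invertibility and Theorem 3.3 ∕ 3.10's kernel bound for `G(U₀)`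
    (hunit : IsUnit (deltaAY i parS (parBY i) Gp U₀)) {BG : ℝ} (hBG : 0 ≤ BG)
    (hO : ∀ b' c (E : 𝔸), ‖GAY i parS (parBY i) Gp U₀ (Pi.single b' E) c‖ ≤ BG * ‖E‖ * Real.exp (-(ρ * tdist1 Nf (ℓB c) (ℓB b'))))
    {ρ' : ℝ} (hρ'0 : 0 ≤ ρ') (hρ' : ρ' < ρ) :
    RawEntryLetters (fun a : Fin (d + 1) → Site (PV d ℓ i.m i.K hd hL) 0 → 𝔸 =>
        LinearMap.toMatrix ((Pi.basis fun _ : FBondY i => b).reindex (Equiv.sigmaEquivProd (FBondY i) κ))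
          ((Pi.basis fun _ : FBondY i => b).reindex (Equiv.sigmaEquivProd (FBondY i) κ)) (GAY i parS (parBY i) Gp (prodCfg U₀ η a)))
      (fun p : FBondY i × κ => ℓB p.1)
      (Rc / (4 * ((cb * ((c₂ * (K₀ * Real.exp (|η| * Rc) *
          ((K₀ * Real.exp (|η| * Rc)) ^ 4 * (c₁ * (K₀ * Real.exp (|η| * Rc) * cl * (K₀ * Real.exp (|η| * Rc))))) *
          (K₀ * Real.exp (|η| * Rc))) +
        1 / 2 * (Nb * (K₀ * Real.exp (|η| * Rc) *
          (2 * (i.cf ^ 2 * (K₀ * Real.exp (|η| * Rc)) ^ 4) * (8 * (K₀ * Real.exp (|η| * Rc) * cl * (K₀ * Real.exp (|η| * Rc))))) *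
          (K₀ * Real.exp (|η| * Rc))))) +
      cQs * ((K₀ * Real.exp (|η| * Rc)) ^ D *
        (ca * (cQ * ((K₀ * Real.exp (|η| * Rc)) ^ D * cl * (K₀ * Real.exp (|η| * Rc)) ^ D))) * (K₀ * Real.exp (|η| * Rc)) ^ D)) * Real.exp (ρ * s) + BP) *
          (cb * cl * BG) * (m * B6.c0 1 ((ρ - ρ') / 3) ^ ν) * (m * B6.c0 1 ((ρ - ρ') / 3) ^ ν)) + 1))
      ρ' (2 * (cb * cl * BG)) := by
  have hA := rawEntryLetters_toMatrix_deltaAY_prodCfg_of_projection i b parS Gp U₀ η hU hUi hK1 hRc.le hc₀ hc₂0 hc₁ hc₂ hNb0 hNb hD hD' hcQ0 hcQs0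
    hca0 hcQ hcQs hca hcb hcb0 hcl hcl0 ℓB hℓp hℓq hρ hP
  have h0 : deltaAY i parS (parBY i) Gp (prodCfg U₀ η 0) * GAY i parS (parBY i) Gp U₀ = 1 := by
    rw [prodCfg_zero]
    exact deltaAY_mul_GAY i hunit
  exact rawEntryLetters_toMatrix_ringInverse_located_of_kernelBound b (fun a => deltaAY i parS (parBY i) Gp (prodCfg U₀ η a)) ℓB hA h0
    hcb hcb0 hcl hcl0 hBG hO hfib hRc hρ'0 hρ'

end Green

end Literature.MathematicalPhysics.QuantumFieldTheory.Balaban1983to89.B13OpsYPencilDeltaALetters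

end
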